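import Summits.Schanuel.Schanuel.Theorems.ZilberEacEquimodularPhases
import Mathlib.Algebra.Polynomial.Eval.Degree
import Mathlib.Algebra.Polynomial.Coeff
import Mathlib.Algebra.Ring.GeomSum
import HarnessLib

/-!
# The equimodular class, XIV: phases of a real polynomial at the integers — rational coefficients
# give periodic phases, one irrational coefficient forbids accumulation at a finite set

HONEST FRAMING.  Cell `pub-schanuel` (Zilber's Exponential-Algebraic Closedness, case ladder;
host summit Schanuel), seat 2, gen 23.  Elementary arithmetic of the phase sequence
`k ↦ urot(g(k)) = e^{2πi g(k)}` of a real polynomial `g ∈ ℝ[X]` (gen 22, file VIII, did `deg g ≤ 2`):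
* **`urot_eval_add_period`**: if every coefficient of positive index is rational, the phases are
  PERIODIC (`D` = the product of the denominators: `g(k + D) - g(k) ∈ ℤ`);
* **`urot_eval_not_near_finset`**: if some coefficient of positive index is irrational, then for
  every finite `F ⊆ ℂ` there is `ε > 0` with `dist(urot(g(k)), F) ≥ ε` for infinitely many `k` —
  WITHOUT Weyl equidistribution: by induction on the degree, an irrational LEADING coefficient passes
  to the finite difference `g(k+1) - g(k)` (whose phases are products of consecutive phases, so
  accumulation at `F` would give accumulation at `F·F̄`), and a rational leading coefficient `q` is
  removed modulo `ℤ` along the subsequence `k ∈ (den q)ℕ`; the base case is Kronecker's density of an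
  irrational rotation in the form of file VIII.
These decide, in files XV–XVI, the resonant / non-resonant alternative for the phase polynomial
`k ↦ P̃(τ' + 2πik)` over graph bases of any degree.  [folklore]; nothing here is specific to
Schanuel's conjecture; Mantova–Masser's question and EC(3,2) stay OPEN.
-/

noncomputable section

open Filter Topology Polynomial

set_option linter.dupNamespace false

namespace Summit.Schanuel.Schanuel.Theorems

/-! ## Part A. Rational coefficients: periodic phases -/

/-- One term of `g(k + D) - g(k)` is an integer when the coefficient is a rational `q` with
`den q ∣ D`: `q·((k + D)^j - k^j) ∈ ℤ`. [folklore] -/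
theorem exists_int_rat_mul_pow_sub_pow (q : ℚ) {D : ℕ} (hden : q.den ∣ D) (k j : ℕ) :
    ∃ n : ℤ, (q : ℝ) * (((k + D : ℕ) : ℝ) ^ j - (k : ℝ) ^ j) = n := by
  obtain ⟨M, hM⟩ := sub_dvd_pow_sub_pow ((k + D : ℕ) : ℤ) (k : ℤ) j
  obtain ⟨e, he⟩ := hden
  refine ⟨q.num * e * M, ?_⟩
  have hq : (q : ℝ) * (q.den : ℝ) = (q.num : ℝ) := by exact_mod_cast Rat.mul_den_eq_num q
  have hM' : (((k + D : ℕ) : ℝ) ^ j - (k : ℝ) ^ j) = ((D : ℕ) : ℝ) * (M : ℝ) := by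
    have h := congrArg (fun x : ℤ => (x : ℝ)) hM
    push_cast at h ⊢
    linear_combination h
  rw [hM', he]
  push_cast
  linear_combination (↑e * ↑M : ℝ) * hq

/-- **Rational coefficients give periodic phases.**  If every coefficient of `g ∈ ℝ[X]` of positive
index is rational then `urot(g(k + D)) = urot(g(k))` for all `k ∈ ℕ`, for some `D ≥ 1`. [folklore] -/
theorem urot_eval_add_period (g : ℝ[X]) (hrat : ∀ j, 1 ≤ j → ∃ q : ℚ, (q : ℝ) = g.coeff j) :
    ∃ D : ℕ, 0 < D ∧ ∀ k : ℕ, urot (g.eval (((k + D : ℕ) : ℝ))) = urot (g.eval (k : ℝ)) := by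
  classical
  -- rational coefficients `qf j` (`j ≥ 1`) and the common denominator
  have hch : ∀ j : ℕ, ∃ q : ℚ, 1 ≤ j → (q : ℝ) = g.coeff j := fun j => by
    by_cases hj : 1 ≤ j
    · obtain ⟨q, hq⟩ := hrat j hj; exact ⟨q, fun _ => hq⟩
    · exact ⟨0, fun h => absurd h hj⟩
  choose qf hqf using hch
  set D : ℕ := ∏ j ∈ Finset.range (g.natDegree + 1), (qf j).den with hD
  have hDpos : 0 < D := Finset.prod_pos fun j _ => (qf j).den_pos
  have hden : ∀ j ∈ Finset.range (g.natDegree + 1), (qf j).den ∣ D := fun j hj =>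
    Finset.dvd_prod_of_mem _ hj
  refine ⟨D, hDpos, fun k => ?_⟩
  -- `g(k + D) - g(k)` is an integer
  have hterm : ∀ j ∈ Finset.range (g.natDegree + 1), ∃ n : ℤ,
      g.coeff j * (((k + D : ℕ) : ℝ) ^ j - (k : ℝ) ^ j) = n := by
    intro j hj
    rcases Nat.eq_zero_or_pos j with h0 | hpos
    · exact ⟨0, by rw [h0]; simp⟩
    · obtain ⟨n, hn⟩ := exists_int_rat_mul_pow_sub_pow (qf j) (hden j hj) k j
      exact ⟨n, by rw [← hqf j hpos]; exact hn⟩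
  choose! nf hnf using hterm
  have hdiff : g.eval (((k + D : ℕ) : ℝ)) = g.eval (k : ℝ) +
      ((∑ j ∈ Finset.range (g.natDegree + 1), nf j : ℤ) : ℝ) := by
    rw [Polynomial.eval_eq_sum_range, Polynomial.eval_eq_sum_range, Int.cast_sum,
      ← sub_eq_iff_eq_add', ← Finset.sum_sub_distrib]
    refine Finset.sum_congr rfl fun j hj => ?_
    rw [← hnf j hj]; ring
  rw [hdiff, urot_add_int]

/-! ## Part B. Transfer of accumulation at a finite set -/

/-- Products of consecutive phases: if `e_k` is eventually within every `ε` of `F`, then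
`e_{k+1} ē_k` is eventually within every `ε` of `F·F̄`. [folklore] -/
theorem near_finset_succ_mul_conj {e : ℕ → ℂ} (he : ∀ k, ‖e k‖ = 1) {F : Finset ℂ}
    (h : ∀ ε : ℝ, 0 < ε → ∃ K : ℕ, ∀ k : ℕ, K ≤ k → ∃ ζ ∈ F, ‖e k - ζ‖ < ε) :
    ∀ ε : ℝ, 0 < ε → ∃ K : ℕ, ∀ k : ℕ, K ≤ k →
      ∃ ζ ∈ (F ×ˢ F).image (fun p : ℂ × ℂ => p.1 * (starRingEnd ℂ) p.2),
        ‖e (k + 1) * (starRingEnd ℂ) (e k) - ζ‖ < ε := by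
  classical
  intro ε hε
  obtain ⟨K, hK⟩ := h (min (ε / 3) 1) (lt_min (by positivity) one_pos)
  refine ⟨K, fun k hk => ?_⟩
  obtain ⟨ζ₁, hζ₁F, hζ₁⟩ := hK (k + 1) (by omega)
  obtain ⟨ζ₂, hζ₂F, hζ₂⟩ := hK k hk
  refine ⟨ζ₁ * (starRingEnd ℂ) ζ₂, Finset.mem_image.2 ⟨(ζ₁, ζ₂), Finset.mk_mem_product hζ₁F hζ₂F, rfl⟩,
    ?_⟩
  have h3 := norm_mul_conj_sub_lt (he k) (min_le_right _ _) hζ₁ hζ₂ (he (k + 1))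
  have : 3 * min (ε / 3) 1 ≤ ε := by linarith [min_le_left (ε / 3) 1]
  linarith

/-! ## Part C. Finite differences and scalings of a real polynomial -/

/-- Coefficients of `g(X + 1)`: `[X^j] g(X+1) = Σ_{i < n} g_i·C(i, j)` for any `n > deg g`.
[folklore] -/
theorem coeff_comp_X_add_one (g : ℝ[X]) {n : ℕ} (hn : g.natDegree < n) (j : ℕ) :
    (g.comp (X + C 1)).coeff j = ∑ i ∈ Finset.range n, g.coeff i * (i.choose j : ℝ) := by
  rw [Polynomial.comp, Polynomial.eval₂_eq_sum_range' _ hn, Polynomial.finsetSum_coeff]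
  refine Finset.sum_congr rfl fun i _ => ?_
  rw [Polynomial.coeff_C_mul, Polynomial.coeff_X_add_C_pow, one_pow, one_mul]

/-- **The finite difference `Δg = g(X+1) - g` of a polynomial of degree `≤ n + 2`** has degree
`≤ n + 1`, `(n+1)`-st coefficient `(n + 2)·g_{n+2}`, and `Δg(k) = g(k+1) - g(k)`. [folklore] -/
theorem finiteDifference_spec (g : ℝ[X]) {n : ℕ} (hg : g.natDegree ≤ n + 2) :
    (g.comp (X + C 1) - g).natDegree ≤ n + 1 ∧
      (g.comp (X + C 1) - g).coeff (n + 1) = (n + 2 : ℝ) * g.coeff (n + 2) ∧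
      ∀ x : ℝ, (g.comp (X + C 1) - g).eval x = g.eval (x + 1) - g.eval x := by
  have hn : g.natDegree < n + 3 := by omega
  refine ⟨?_, ?_, fun x => by simp [Polynomial.eval_comp]⟩
  · rw [Polynomial.natDegree_le_iff_coeff_eq_zero]
    intro m hm
    have hm' : n + 1 < m := by exact_mod_cast hm
    rw [Polynomial.coeff_sub, coeff_comp_X_add_one g hn]
    rcases eq_or_lt_of_le (show n + 2 ≤ m by omega) with h | h
    · subst h
      rw [Finset.sum_eq_single (n + 2)]
      · simp
      · intro i hi hne
        have hi' := Finset.mem_range.1 hi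
        rw [Nat.choose_eq_zero_of_lt (by omega), Nat.cast_zero, mul_zero]
      · intro h; exact absurd (Finset.mem_range.2 (by omega)) h
    · rw [Finset.sum_eq_zero, Polynomial.coeff_eq_zero_of_natDegree_lt (by omega), sub_zero]
      intro i hi
      rw [Nat.choose_eq_zero_of_lt (by have := Finset.mem_range.1 hi; omega), Nat.cast_zero, mul_zero]
  · rw [Polynomial.coeff_sub, coeff_comp_X_add_one g hn, Finset.sum_range_succ, Finset.sum_range_succ,
      Finset.sum_eq_zero, zero_add, Nat.choose_self, Nat.choose_succ_self_right]
    · push_cast; ring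
    · intro i hi
      rw [Nat.choose_eq_zero_of_lt (by have := Finset.mem_range.1 hi; omega), Nat.cast_zero, mul_zero]

/-- **Scaling out a rational top coefficient.**  `deg g ≤ n + 2`, `g_{n+2} = q ∈ ℚ`, `D = den q`:
the polynomial `g♯ = Σ_{i ≤ n+1} g_i D^i X^i` has degree `≤ n + 1`, coefficients `g♯_i = g_i D^i`
(`i ≤ n + 1`), and `urot(g(Dk)) = urot(g♯(k))` for every `k ∈ ℕ` (the top term `q D^{n+2} k^{n+2}` is
an integer). [folklore] -/
theorem scaledTruncation_spec (g : ℝ[X]) {n : ℕ} (hg : g.natDegree ≤ n + 2) (q : ℚ)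
    (hq : (q : ℝ) = g.coeff (n + 2)) :
    (∑ i ∈ Finset.range (n + 2), Polynomial.monomial i (g.coeff i * (q.den : ℝ) ^ i)).natDegree ≤ n + 1 ∧
      (∀ i, i ≤ n + 1 → (∑ i ∈ Finset.range (n + 2),
        Polynomial.monomial i (g.coeff i * (q.den : ℝ) ^ i)).coeff i = g.coeff i * (q.den : ℝ) ^ i) ∧
      ∀ k : ℕ, urot (g.eval (((q.den * k : ℕ) : ℝ))) =
        urot ((∑ i ∈ Finset.range (n + 2), Polynomial.monomial i (g.coeff i * (q.den : ℝ) ^ i)).eval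
          (k : ℝ)) := by
  set D : ℕ := q.den with hD
  set gs : ℝ[X] := ∑ i ∈ Finset.range (n + 2), Polynomial.monomial i (g.coeff i * (D : ℝ) ^ i) with hgs
  have hcoeff : ∀ i, gs.coeff i = if i < n + 2 then g.coeff i * (D : ℝ) ^ i else 0 := by
    intro i
    rw [hgs, Polynomial.finsetSum_coeff]
    simp only [Polynomial.coeff_monomial, Finset.sum_ite_eq', Finset.mem_range]
  refine ⟨?_, fun i hi => by rw [hcoeff, if_pos (by omega)], fun k => ?_⟩
  · rw [Polynomial.natDegree_le_iff_coeff_eq_zero]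
    intro m hm
    have hm' : n + 1 < m := by exact_mod_cast hm
    rw [hcoeff, if_neg (by omega)]
  · have hn : g.natDegree < n + 3 := by omega
    have hgs_deg : gs.natDegree < n + 2 := by
      refine lt_of_le_of_lt ?_ (Nat.lt_succ_self _)
      rw [Polynomial.natDegree_le_iff_coeff_eq_zero]
      intro m hm
      have hm' : n + 1 < m := by exact_mod_cast hm
      rw [hcoeff, if_neg (by omega)]
    have hqD : (q : ℝ) * (D : ℝ) = (q.num : ℝ) := by rw [hD]; exact_mod_cast Rat.mul_den_eq_num q
    have hdiff : g.eval (((D * k : ℕ) : ℝ)) = gs.eval (k : ℝ) + ((q.num * D ^ (n + 1) * k ^ (n + 2) : ℤ) : ℝ) := by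
      rw [Polynomial.eval_eq_sum_range' hn, Polynomial.eval_eq_sum_range' hgs_deg,
        Finset.sum_range_succ _ (n + 2)]
      have h1 : ∑ i ∈ Finset.range (n + 2), g.coeff i * (((D * k : ℕ) : ℝ)) ^ i =
          ∑ i ∈ Finset.range (n + 2), gs.coeff i * (k : ℝ) ^ i := by
        refine Finset.sum_congr rfl fun i hi => ?_
        rw [hcoeff, if_pos (Finset.mem_range.1 hi)]
        push_cast; ring
      rw [h1, ← hq]
      push_cast
      have e : (q : ℝ) * ((D : ℝ) * (k : ℝ)) ^ (n + 2) =
          (q : ℝ) * (D : ℝ) * (D : ℝ) ^ (n + 1) * (k : ℝ) ^ (n + 2) := by ring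
      rw [e, hqD]
    rw [hdiff, urot_add_int]

/-! ## Part D. One irrational coefficient: no accumulation at a finite set -/

/-- The induction behind `urot_eval_not_near_finset`: degree `≤ n + 1`. [folklore] -/
theorem urot_eval_not_near_finset_aux (n : ℕ) : ∀ g : ℝ[X], g.natDegree ≤ n + 1 →
    (∃ j, 1 ≤ j ∧ Irrational (g.coeff j)) → ∀ F : Finset ℂ,
      ∃ ε : ℝ, 0 < ε ∧ ∀ K : ℕ, ∃ k : ℕ, K ≤ k ∧ ∀ ζ ∈ F, ε ≤ ‖urot (g.eval (k : ℝ)) - ζ‖ := by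
  classical
  induction n with
  | zero =>
    intro g hg hirr F
    obtain ⟨j, hj1, hj⟩ := hirr
    have hj' : j = 1 := by
      by_contra hne
      have : g.coeff j = 0 := Polynomial.coeff_eq_zero_of_natDegree_lt (by omega)
      rw [this] at hj
      exact hj ⟨0, by simp⟩
    subst hj'
    obtain ⟨ε, hε, hfar⟩ := urot_quadratic_not_near_finset (x := 0) (Or.inr hj) (g.coeff 0) F
    refine ⟨ε, hε, fun K => ?_⟩
    obtain ⟨k, hk, hkfar⟩ := hfar K
    refine ⟨k, hk, fun ζ hζ => ?_⟩
    have e : g.eval (k : ℝ) = 0 * (k : ℝ) ^ 2 + g.coeff 1 * k + g.coeff 0 := by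
      conv_lhs => rw [Polynomial.eq_X_add_C_of_natDegree_le_one hg]
      simp only [Polynomial.eval_add, Polynomial.eval_mul, Polynomial.eval_C, Polynomial.eval_X]
      ring
    rw [e]
    exact hkfar ζ hζ
  | succ n ih =>
    intro g hg hirr F
    obtain ⟨j, hj1, hj⟩ := hirr
    by_contra hacc
    push Not at hacc
    -- `hacc`: every `ε > 0` admits `K` beyond which the phase is within `ε` of `F`
    have hacc' : ∀ ε : ℝ, 0 < ε → ∃ K : ℕ, ∀ k : ℕ, K ≤ k → ∃ ζ ∈ F, ‖urot (g.eval (k : ℝ)) - ζ‖ < ε := by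
      intro ε hε
      obtain ⟨K, hK⟩ := hacc ε hε
      exact ⟨K, fun k hk => by
        obtain ⟨ζ, hζ, hlt⟩ := hK k hk
        exact ⟨ζ, hζ, hlt⟩⟩
    by_cases htop : Irrational (g.coeff (n + 2))
    · -- Case A: irrational top coefficient — pass to the finite difference
      obtain ⟨hΔdeg, hΔtop, hΔev⟩ := finiteDifference_spec g hg
      have hΔirr : ∃ j, 1 ≤ j ∧ Irrational ((g.comp (X + C 1) - g).coeff j) := by
        refine ⟨n + 1, by omega, ?_⟩
        rw [hΔtop, show (n + 2 : ℝ) = ((n + 2 : ℕ) : ℝ) by push_cast; ring, mul_comm]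
        exact htop.mul_natCast (by omega)
      set F' : Finset ℂ := (F ×ˢ F).image (fun p : ℂ × ℂ => p.1 * (starRingEnd ℂ) p.2) with hF'
      obtain ⟨ε, hε, hfar⟩ := ih _ hΔdeg hΔirr F'
      have htrans := near_finset_succ_mul_conj (e := fun k : ℕ => urot (g.eval (k : ℝ)))
        (fun k => norm_urot _) hacc' ε hε
      obtain ⟨K, hK⟩ := htrans
      obtain ⟨k, hk, hkfar⟩ := hfar K
      obtain ⟨ζ, hζF', hζ⟩ := hK k hk
      have hphase : urot ((g.comp (X + C 1) - g).eval (k : ℝ)) =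
          urot (g.eval (((k + 1 : ℕ) : ℝ))) * (starRingEnd ℂ) (urot (g.eval (k : ℝ))) := by
        rw [hΔev, ← urot_sub_eq_mul_conj]
        push_cast
        ring_nf
      have := hkfar ζ hζF'
      rw [hphase] at this
      exact absurd hζ (not_lt.2 this)
    · -- Case B: rational top coefficient `q` — scale by `den q` and truncate
      obtain ⟨q, hq⟩ : ∃ q : ℚ, (q : ℝ) = g.coeff (n + 2) := by
        simpa [Irrational] using htop
      have hjle : j ≤ n + 1 := by
        by_contra hlt
        have hj2 : j = n + 2 ∨ n + 2 < j := by omega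
        rcases hj2 with h | h
        · exact htop (h ▸ hj)
        · have : g.coeff j = 0 := Polynomial.coeff_eq_zero_of_natDegree_lt (by omega)
          rw [this] at hj
          exact hj ⟨0, by simp⟩
      obtain ⟨hsdeg, hscoeff, hsev⟩ := scaledTruncation_spec g hg q hq
      set gs : ℝ[X] := ∑ i ∈ Finset.range (n + 2), Polynomial.monomial i (g.coeff i * (q.den : ℝ) ^ i)
        with hgs
      have hsirr : ∃ j, 1 ≤ j ∧ Irrational (gs.coeff j) := by
        refine ⟨j, hj1, ?_⟩
        rw [hscoeff j hjle, show ((q.den : ℝ)) ^ j = ((q.den ^ j : ℕ) : ℝ) by push_cast; ring]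
        exact hj.mul_natCast (pow_ne_zero _ q.den_pos.ne')
      obtain ⟨ε, hε, hfar⟩ := ih gs hsdeg hsirr F
      obtain ⟨K, hK⟩ := hacc' ε hε
      obtain ⟨k, hk, hkfar⟩ := hfar K
      have hDk : K ≤ q.den * k := le_trans hk (Nat.le_mul_of_pos_left k q.den_pos)
      obtain ⟨ζ, hζF, hζ⟩ := hK (q.den * k) hDk
      rw [hsev k] at hζ
      exact absurd hζ (not_lt.2 (hkfar ζ hζF))

/-- **One irrational coefficient forbids accumulation at a finite set.**  If some coefficient of
`g ∈ ℝ[X]` of positive index is irrational, then for every finite `F ⊆ ℂ` there is `ε > 0` such that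
`dist(urot(g(k)), F) ≥ ε` for infinitely many `k ∈ ℕ`. [folklore] (new in this form; no Weyl
equidistribution is used) -/
theorem urot_eval_not_near_finset (g : ℝ[X]) (hirr : ∃ j, 1 ≤ j ∧ Irrational (g.coeff j))
    (F : Finset ℂ) : ∃ ε : ℝ, 0 < ε ∧ ∀ K : ℕ, ∃ k : ℕ, K ≤ k ∧
      ∀ ζ ∈ F, ε ≤ ‖urot (g.eval (k : ℝ)) - ζ‖ :=
  urot_eval_not_near_finset_aux g.natDegree g (Nat.le_succ _) hirr F

/-! ## Part E. The dichotomy -/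

/-- **Dichotomy for the phases of a real polynomial at the integers**: either they are periodic, or
they do not accumulate at any finite set. [folklore] -/
theorem urot_eval_periodic_or_not_near_finset (g : ℝ[X]) :
    (∃ D : ℕ, 0 < D ∧ ∀ k : ℕ, urot (g.eval (((k + D : ℕ) : ℝ))) = urot (g.eval (k : ℝ))) ∨
      (∀ F : Finset ℂ, ∃ ε : ℝ, 0 < ε ∧ ∀ K : ℕ, ∃ k : ℕ, K ≤ k ∧
        ∀ ζ ∈ F, ε ≤ ‖urot (g.eval (k : ℝ)) - ζ‖) := by
  by_cases h : ∃ j, 1 ≤ j ∧ Irrational (g.coeff j)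
  · exact Or.inr fun F => urot_eval_not_near_finset g h F
  · refine Or.inl (urot_eval_add_period g fun j hj => ?_)
    push Not at h
    have := h j hj
    simpa [Irrational] using this

end Summit.Schanuel.Schanuel.Theorems
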